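import Summits.ABC.IUTFork.Conditional.WRowFrey343Packages
import Summits.ABC.IUTFork.Conditional.WRowFrey301327048Packages
import Summits.ABC.IUTFork.Cor312GenuineKWildDifferent
import Literature.IUT.LogVolume.UnitLogInnerRadiusDeepTieWitness
import HarnessLib

/-!
# R-W WINDOW-TABLE, W1 ROWS 1–4 UNCONDITIONAL — packages: the uniform local package at the integer slot, the divisibilities of the
# unknown ramification index at the bad fibre of the two triples, and the symbolic integer cells for EVERY admissible index

PROOF-ONLY file (D-0012; 0 definitions, 0 `Prop` facts) of the abc-iut cell — D-0079 RESCUE sub-cell R-W «WINDOW Θ-SIDE INEQUALITY», W1 ROW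
DECISIONS composer seat abc-iut-W-row-1 (gen 2); packages for the UNCONDITIONAL versions of rows 1–4 of HOME/plan/rescue/R-W/OPEN-10.md
(sha16 1b0025ee7a8ba6d7): `pilotDataOfK:frey-283-8251953125-8251953408:{13,17,19}` and `pilotDataOfK:frey-1-301327047-301327048:23`
(consumers: `WRowFrey283Unconditional{Thirteen,Seventeen,Nineteen}.lean`, `WRowFrey301327048Unconditional.lean`). Pattern of abc-iut-w4-d094's
`WRowFrey343Packages` (row 5), whose §2 lemmas are consumed BY NAME; the wild different of abc-iut-W-neg-1 (`Cor312GenuineKWildDifferent`), the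
integer-slot inner witness of abc-iut-c312-5 (`UnitLogInnerRadiusDeepTieWitness`) and the divisibilities of abc-iut-W-neg-1 / W-neg-2
(`Cor312GenuineKWildLowerBound`, `Cor312GenuineKCyclotomicLowerBound`) are consumed BY NAME. TAKES NO SIDE on [IUTchIII] Cor. 3.12 or on any author.

* §1 `WRow.natCast_ne_pow_mul_sub_one` (`l ∣ e`, `l ≠ p`, `l ∤ p − 1` ⇒ `e` is off the cyclotomic indices `p^c(p−1)`);
  `WRow.inner_witness_slot` — in EVERY proper ultrametric `ℚ_p`-field (`p` odd) a NON-member of `log_p(𝒪^×)` of norm `≤ p^{−(⌊e/(p−1)⌋−1)/e}`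
  (abc-iut-c312-5's integer slot, hypothesis-free); `WRow.outer_member_min` — with `e` off the cyclotomic indices a MEMBER of norm
  `≥ p^{−min(p^a − a·e, p^b − b·e)/e}` (abc-iut-w4-d094).
* §2 `WRow.dvd_absRamificationIdx_frey283` / `WRow.dvd_absRamificationIdx_frey301327048` — at a bad fibre point `x | p` of a genuine datum over the
  triple at ANY level `l`: `30·l ∣ e` over `3`, `60·l ∣ e` over `5` (gcd(15, t) = 1), `15·l ∣ e` at the tame poles with `gcd(15,t) = 1`, `15·l ∣ 3e` at
  those with `t = 3` — abc-iut-W-neg-1 / W-neg-2's lower bounds read at the pole orders of `WRowFrey283Packages` / `WRowFrey301327048Packages`.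
* (cells: `WRowUnconditionalCellsA/B.lean`) the integer cells `e·⌊(j²P − j·D − (j+1)·ρin)/e⌋ + (j+1)·ρout ≤ P` for EVERY admissible `e = e₀·n` (`n ≥ 1`) at every label, with
  `D = 2e − 1`, `ρin = e/(p−1)` at the wild `3, 5` and `D = e − 1`, `ρin = 1` at the tame poles, `ρout = min(p^a − a·e, p^b − b·e)`
  (`nlinarith` after dropping the floor; desk check HOME/…/work/cells.py: every cell for `n < 400`, and the no-floor form is linear in `n`).
HONEST SCOPE: classical local/global number theory plus the cell's typed containers; nothing here bears on the printed inequality; typed ≠ proved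
elsewhere; no abc claim. [cite: NeukirchANT1999, Ch. II (5.5)–(5.7)] [cite: CasselsFrohlichANT1967, Ch. VII §1.1] [cite: SilvermanATAEC1994, V.5 Thm. 5.3]
[cite: Mochizuki2012, IUTchI Def. 3.1 (b),(c) pp. 61–62, Rmk. 3.1.5 p. 65, Ex. 3.2 (iv) p. 71; IUTchIII Cor. 3.12 Step (xi-f) p. 184; IUTchIV Prop. 1.1 p. 9, Prop. 1.2 (i)(ii) p. 10, Prop. 1.4 (ii) p. 13, Cor. 2.2 (ii) proof (P5) p. 46] [claim: Mochizuki2012, status: disputed] for the IUT locutions only.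
-/

noncomputable section

open Set Function Metric NumberField IsDedekindDomain

namespace Summit.ABC.IUTFork.Conditional

open Thm311 Thm311.Real Cor312 Cor312Vol Cor312Prov Literature.IUT.LogThetaLattice Literature.IUT.LogVolume
  Literature.IUT.HodgeTheaters Literature.IUT.LogVolume.Cor22
open Literature.NumberTheory.NumberFields Literature.NumberTheory.GaloisRepresentations.Ultrametric
open Literature.NumberTheory.DiophantineGeometry Literature.NumberTheory.DiophantineGeometry.GenEll

/-! ## §1. Off the cyclotomic indices; the uniform local package at the integer slot -/

/-- **`e` is off the cyclotomic indices** `p^c·(p−1)` as soon as a prime `l ≠ p` with `l ∤ p − 1` divides `e`. [folklore] -/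
theorem WRow.natCast_ne_pow_mul_sub_one {l p₀ e : ℕ} (hl : l.Prime) (hp₀ : p₀.Prime) (hlp : l ≠ p₀) (hl1 : ¬ l ∣ p₀ - 1)
    (hle : l ∣ e) (c : ℕ) : (e : ℤ) ≠ (p₀ : ℤ) ^ c * ((p₀ : ℤ) - 1) := by
  intro h
  have h1 : 1 ≤ p₀ := hp₀.one_lt.le
  have h' : e = p₀ ^ c * (p₀ - 1) := by
    have : (e : ℤ) = ((p₀ ^ c * (p₀ - 1) : ℕ) : ℤ) := by rw [h]; push_cast; rw [Nat.cast_sub h1, Nat.cast_one]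
    exact_mod_cast this
  rw [h'] at hle
  rcases (Nat.Prime.dvd_mul hl).mp hle with h2 | h2
  · exact hlp ((Nat.prime_dvd_prime_iff_eq hl hp₀).mp (hl.dvd_of_dvd_pow h2))
  · exact hl1 h2

section Local

variable (p : ℕ) [hp : Fact p.Prime] {K : Type} [NontriviallyNormedField K] [instK : NormedAlgebra ℚ_[p] K]
  [IsUltrametricDist K] [ProperSpace K]

include instK in
/-- **Inner witness at the integer slot** (`p` odd, ANY `K`, no tie hypothesis): a non-member of `log_p(𝒪_K^×)` of norm `≤ p^{−(ρin−1)/e}` with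
`ρin = ⌊e/(p−1)⌋` — abc-iut-c312-5's `exists_not_mem_logUnits_norm_le_rpow_div_intSlot`, in the socket's binder form. [cite: NeukirchANT1999, Ch. II (5.5)–(5.7)] -/
theorem WRow.inner_witness_slot (hp2 : p ≠ 2) {e : ℕ} (hE : absRamificationIdx p K = e) {ρin : ℤ}
    (hρin : ρin = ((e / (p - 1) : ℕ) : ℤ)) :
    ∃ z : K, z ∉ logUnits K ∧ ‖z‖ ≤ (p : ℝ) ^ (-(((ρin : ℝ) - 1) / (e : ℝ))) := by
  obtain ⟨ϖ, hϖ⟩ := exists_isUniformizer (F := K)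
  have h := LogEnvelope.exists_not_mem_logUnits_norm_le_rpow_div_intSlot p hϖ hp2
  rw [hE] at h
  rw [hρin]
  exact h

include instK in
/-- **Outer member below two envelope terms, socket form** (`e` off the cyclotomic indices, ANY `K`): a member of `log_p(𝒪_K^×)` of norm
`≥ p^{−ρout/e}` with `ρout = min(p^a − a·e, p^b − b·e)` — abc-iut-w4-d094's `WRow.exists_mem_logUnits_rpow_min_le_norm` (abc-iut-c312-3's envelope
member + `envelope_le_index`), the prime read as an integer numeral `p'`. [cite: NeukirchANT1999, Ch. II (5.5)] -/
theorem WRow.outer_member_min {e : ℕ} (hE : absRamificationIdx p K = e) (hne : ∀ c : ℕ, (e : ℤ) ≠ (p : ℤ) ^ c * ((p : ℤ) - 1))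
    (a b : ℕ) {p' : ℤ} (hp' : (p : ℤ) = p') {ρout : ℤ} (hρout : ρout = min (p' ^ a - (a : ℤ) * (e : ℤ)) (p' ^ b - (b : ℤ) * (e : ℤ))) :
    ∃ z ∈ logUnits K, (p : ℝ) ^ (-((ρout : ℝ) / (e : ℝ))) ≤ ‖z‖ := by
  subst hp'
  rw [hρout]
  exact WRow.exists_mem_logUnits_rpow_min_le_norm p hE hne a b

end Local

/-! ## §2. Divisibilities of the ramification index at the bad fibre of the two triples (any level `l`) -/

/-- **The triple `283 + 5¹¹·13² = 2⁸·3⁸·17³`, any level `l`**: at a fibre point `x | p` of a genuine datum over `(ratPoint (283/c), l)` with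
`p ≠ l`: `30·l ∣ e(K_x/ℚ_3)` (`t = 8`), `60·l ∣ e(K_x/ℚ_5)` (`t = 11`), `15·l ∣ e` over `13` (`t = 2`) and `283` (`t = 1`), `15·l ∣ 3·e` over `17`
(`t = 3`) — abc-iut-W-neg-1 / W-neg-2's lower bounds (`…_three_of_coprime`, `…_five_of_coprime`, `fifteen_mul_prime_dvd_…`) at the pole orders
`ord_p j = −2·v_p(abc)` of `WRow.ord_jInv_frey283`. [cite: SilvermanATAEC1994, V.5 Thm. 5.3 and Cor. 5.4] [cite: Washington1997, Prop. 2.1]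
[claim: Mochizuki2012, status: disputed] -/
theorem WRow.dvd_absRamificationIdx_frey283 {l : ℕ} (T : Cor22.ThetaVolumeDatumAt (ratPoint ((283 : ℚ) / 8251953408)) l)
    (pp : Nat.Primes) (hpl : (pp : ℕ) ≠ l) :
    letI := T.instFieldF; letI := T.instNumberFieldF; letI := T.instAlgebraF; letI := T.instFieldK
    letI := T.instNumberFieldK; letI := T.instAlgebraK; letI := T.instFieldFbar; letI := T.instAlgebraFbar
    letI := T.instAlgebraKFbar; letI := T.instIsElliptic
    haveI : Fact (pp : ℕ).Prime := ⟨pp.2⟩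
    ∀ x : (thetaIndex (pilotDataOfK T.D T.K)).Fibre (.inr pp),
      ((pp : ℕ) = 3 → 30 * l ∣ absRamificationIdx (pp : ℕ) (kOf (pilotDataOfK T.D T.K) pp.1 x)) ∧
      ((pp : ℕ) = 5 → 60 * l ∣ absRamificationIdx (pp : ℕ) (kOf (pilotDataOfK T.D T.K) pp.1 x)) ∧
      ((pp : ℕ) = 13 → 15 * l ∣ absRamificationIdx (pp : ℕ) (kOf (pilotDataOfK T.D T.K) pp.1 x)) ∧
      ((pp : ℕ) = 17 → 15 * l ∣ absRamificationIdx (pp : ℕ) (kOf (pilotDataOfK T.D T.K) pp.1 x) * 3) ∧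
      ((pp : ℕ) = 283 → 15 * l ∣ absRamificationIdx (pp : ℕ) (kOf (pilotDataOfK T.D T.K) pp.1 x)) := by
  letI := T.instFieldF; letI := T.instNumberFieldF; letI := T.instAlgebraF; letI := T.instFieldK
  letI := T.instNumberFieldK; letI := T.instAlgebraK; letI := T.instFieldFbar; letI := T.instAlgebraFbar
  letI := T.instAlgebraKFbar; letI := T.instIsElliptic
  haveI : Fact (pp : ℕ).Prime := ⟨pp.2⟩
  intro x
  have hpole : ∀ {p₀ : ℕ} (t : ℕ), (p₀ = 3 ∧ t = 8) ∨ (p₀ = 5 ∧ t = 11) ∨ (p₀ = 13 ∧ t = 2) ∨ (p₀ = 17 ∧ t = 3) ∨ (p₀ = 283 ∧ t = 1) →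
      ∀ v : HeightOneSpectrum (𝓞 ℚ), Rat.HeightOneSpectrum.natGenerator v = p₀ →
        ord ℚ v (jInv ((283 : ℚ) / 8251953408)) = -(2 * (t : ℤ)) := by
    intro p₀ t ht v hv
    have hp₀ : p₀ = 3 ∨ p₀ = 5 ∨ p₀ = 13 ∨ p₀ = 17 ∨ p₀ = 283 := by
      rcases ht with h | h | h | h | h <;> simp [h.1]
    rw [WRow.ord_jInv_frey283 v hv hp₀]
    rcases ht with ⟨rfl, rfl⟩ | ⟨rfl, rfl⟩ | ⟨rfl, rfl⟩ | ⟨rfl, rfl⟩ | ⟨rfl, rfl⟩ <;> norm_num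
  refine ⟨fun hp => ?_, fun hp => ?_, fun hp => ?_, fun hp => ?_, fun hp => ?_⟩
  · have hpp : pp = ⟨3, Nat.prime_three⟩ := Subtype.ext hp
    subst hpp
    exact GenuineK.thirty_mul_prime_dvd_absRamificationIdx_kOf_three_of_coprime T (fun h => hpl h.symm) (t := 8) (by norm_num)
      (by decide) (hpole 8 (Or.inl ⟨rfl, rfl⟩)) x
  · have hpp : pp = ⟨5, Nat.prime_five⟩ := Subtype.ext hp
    subst hpp
    exact GenuineK.sixty_mul_prime_dvd_absRamificationIdx_kOf_five_of_coprime T (fun h => hpl h.symm) (t := 11) (by norm_num)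
      (by decide) (hpole 11 (Or.inr (Or.inl ⟨rfl, rfl⟩))) x
  · exact GenuineK.fifteen_mul_prime_dvd_absRamificationIdx_kOf_ratPoint_of_coprime T pp (by rw [hp]; norm_num) hpl (t := 2)
      (by norm_num) (by decide) (fun v hv => hpole 2 (Or.inr (Or.inr (Or.inl ⟨hp, rfl⟩))) v hv) x
  · exact GenuineK.fifteen_mul_prime_dvd_absRamificationIdx_kOf_mul_ratPoint T pp (by rw [hp]; norm_num) hpl (t := 3)
      (by norm_num) (fun v hv => hpole 3 (Or.inr (Or.inr (Or.inr (Or.inl ⟨hp, rfl⟩)))) v hv) x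
  · exact GenuineK.fifteen_mul_prime_dvd_absRamificationIdx_kOf_ratPoint_of_coprime T pp (by rw [hp]; norm_num) hpl (t := 1)
      (by norm_num) (by decide) (fun v hv => hpole 1 (Or.inr (Or.inr (Or.inr (Or.inr ⟨hp, rfl⟩)))) v hv) x

/-- **The triple `1 + 3¹⁶·7 = 2³·11·23·53³`, any level `l`**: at a fibre point `x | p` of a genuine datum over `(ratPoint (1/c), l)` with `p ≠ l`:
`30·l ∣ e(K_x/ℚ_3)` (`t = 16`), `15·l ∣ e` over `7` and `11` (`t = 1`), `15·l ∣ 3·e` over `53` (`t = 3`).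
[cite: SilvermanATAEC1994, V.5 Thm. 5.3 and Cor. 5.4] [cite: Washington1997, Prop. 2.1] [claim: Mochizuki2012, status: disputed] -/
theorem WRow.dvd_absRamificationIdx_frey301327048 {l : ℕ} (T : Cor22.ThetaVolumeDatumAt (ratPoint ((1 : ℚ) / 301327048)) l)
    (pp : Nat.Primes) (hpl : (pp : ℕ) ≠ l) :
    letI := T.instFieldF; letI := T.instNumberFieldF; letI := T.instAlgebraF; letI := T.instFieldK
    letI := T.instNumberFieldK; letI := T.instAlgebraK; letI := T.instFieldFbar; letI := T.instAlgebraFbar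
    letI := T.instAlgebraKFbar; letI := T.instIsElliptic
    haveI : Fact (pp : ℕ).Prime := ⟨pp.2⟩
    ∀ x : (thetaIndex (pilotDataOfK T.D T.K)).Fibre (.inr pp),
      ((pp : ℕ) = 3 → 30 * l ∣ absRamificationIdx (pp : ℕ) (kOf (pilotDataOfK T.D T.K) pp.1 x)) ∧
      ((pp : ℕ) = 7 → 15 * l ∣ absRamificationIdx (pp : ℕ) (kOf (pilotDataOfK T.D T.K) pp.1 x)) ∧
      ((pp : ℕ) = 11 → 15 * l ∣ absRamificationIdx (pp : ℕ) (kOf (pilotDataOfK T.D T.K) pp.1 x)) ∧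
      ((pp : ℕ) = 53 → 15 * l ∣ absRamificationIdx (pp : ℕ) (kOf (pilotDataOfK T.D T.K) pp.1 x) * 3) := by
  letI := T.instFieldF; letI := T.instNumberFieldF; letI := T.instAlgebraF; letI := T.instFieldK
  letI := T.instNumberFieldK; letI := T.instAlgebraK; letI := T.instFieldFbar; letI := T.instAlgebraFbar
  letI := T.instAlgebraKFbar; letI := T.instIsElliptic
  haveI : Fact (pp : ℕ).Prime := ⟨pp.2⟩
  intro x
  have hpole : ∀ {p₀ : ℕ} (t : ℕ), (p₀ = 3 ∧ t = 16) ∨ (p₀ = 7 ∧ t = 1) ∨ (p₀ = 11 ∧ t = 1) ∨ (p₀ = 53 ∧ t = 3) →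
      ∀ v : HeightOneSpectrum (𝓞 ℚ), Rat.HeightOneSpectrum.natGenerator v = p₀ →
        ord ℚ v (jInv ((1 : ℚ) / 301327048)) = -(2 * (t : ℤ)) := by
    intro p₀ t ht v hv
    have hp₀ : p₀ = 3 ∨ p₀ = 7 ∨ p₀ = 11 ∨ p₀ = 23 ∨ p₀ = 53 := by
      rcases ht with h | h | h | h <;> simp [h.1]
    rw [WRow.ord_jInv_frey301327048 v hv hp₀]
    rcases ht with ⟨rfl, rfl⟩ | ⟨rfl, rfl⟩ | ⟨rfl, rfl⟩ | ⟨rfl, rfl⟩ <;> norm_num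
  refine ⟨fun hp => ?_, fun hp => ?_, fun hp => ?_, fun hp => ?_⟩
  · have hpp : pp = ⟨3, Nat.prime_three⟩ := Subtype.ext hp
    subst hpp
    exact GenuineK.thirty_mul_prime_dvd_absRamificationIdx_kOf_three_of_coprime T (fun h => hpl h.symm) (t := 16) (by norm_num)
      (by decide) (hpole 16 (Or.inl ⟨rfl, rfl⟩)) x
  · exact GenuineK.fifteen_mul_prime_dvd_absRamificationIdx_kOf_ratPoint_of_coprime T pp (by rw [hp]; norm_num) hpl (t := 1)
      (by norm_num) (by decide) (fun v hv => hpole 1 (Or.inr (Or.inl ⟨hp, rfl⟩)) v hv) x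
  · exact GenuineK.fifteen_mul_prime_dvd_absRamificationIdx_kOf_ratPoint_of_coprime T pp (by rw [hp]; norm_num) hpl (t := 1)
      (by norm_num) (by decide) (fun v hv => hpole 1 (Or.inr (Or.inr (Or.inl ⟨hp, rfl⟩))) v hv) x
  · exact GenuineK.fifteen_mul_prime_dvd_absRamificationIdx_kOf_mul_ratPoint T pp (by rw [hp]; norm_num) hpl (t := 3)
      (by norm_num) (fun v hv => hpole 3 (Or.inr (Or.inr (Or.inr ⟨hp, rfl⟩))) v hv) x

end Summit.ABC.IUTFork.Conditional

end
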